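import Mathlib
import HarnessLib

/-!
# Markman 2025 — the similarity `η_λ` (Lemma 2.2.4), `f := η_{√−d}` ((2.4.1)), the bilinear form `g_P`
# (Lemma 2.4.2), the isotropic subspaces `W₁, W₂` of (2.4.4)–(2.4.6), and the `Θ(ȳ ∧ I(y))` expansion in the
# proof of Proposition 2.4.4 — the printed one-line deductions of [M] §2.2 / §2.4, kernel-checked

E. Markman: [M] *Cycles on abelian 2n-folds of Weil type from secant sheaves on abelian n-folds*,
arXiv:2502.03415 **v2** (2025-06-08), bib `Markman2025SecantWeil` — UNREFEREED PREPRINT. Pages/lines = PyMuPDF lines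
of the public v2 PDF (sha256/16 `8155aa33870069b8`), read at seat lit-w-markman g15 (pub-hsemireg LIT-W, 2026-08-23;
sheet `LOCATOR-SHEET-MARKMAN.md` §46), BY EYE on 160-dpi renders `HOME/lit/Markman-renders-litw-markman-g15/`
`r_mar25_v2_p14_eta_L224.png`, `…p19_sec24_f_Xi.png`, `…p20_L242.png`, `…p21_244_246.png`, `…p21_P244.png`,
`…p22_top.png`. Companion of `ProductWeilTypeDiscriminant.lean` (Lemma 3.1.3; its Appendix takes `f² = −d` and
`(f x, f y)_V = d(x, y)_V` as HYPOTHESES — here they are DERIVED from the printed definition of `η_λ`).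

## What is printed (verbatim, v2)
* p. 14 L9–34: «Let `d` be a rational number, such that `−d` is not a square of a rational number. Set `K := ℚ[√−d]`.
  Let `σ : K → K` be the involution in `Gal(K/ℚ)`. … Let `Nm : K → ℚ` be the norm map `Nm(λ) = λσ(λ)`. Denote the
  group of rational similarities of `V_ℚ` by (2.2.3) `Õ(V_ℚ) := {g ∈ GL(V_ℚ) : (g(v₁), g(v₂)) = c(v₁, v₂), for some
  c ∈ Nm(K^×)}`. Assume that `P ⊂ S⁺_ℚ` is a non-isotropic 2-dimensional subspace, which intersects the spinor
  variety in `ℙ(S⁺_K)` in two `σ`-conjugate points `ℓ₁` and `ℓ₂` corresponding to two maximal isotropic subspaces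
  `W₁` and `W₂` of `V_K`. The vanishing `W₁ ∩ W₂ = (0)` holds, by Lemma 2.2.1. The subset `V_ℚ` of `V_K` is equal
  to `{v₁ + σ(v₁) : v₁ ∈ W₁}`. Given `λ ∈ K^×`, let `η_λ : V_K → V_K` act on `W₁` by multiplication by `λ` and on
  `W₂` by multiplication by `σ(λ)`. Then `η_λ` leaves `V_ℚ` invariant and we get the homomorphism (2.2.4)
  `η : K^× → GL(V_ℚ)` sending `λ` to the restriction of `η_λ` to `V_ℚ`.»
* LEMMA 2.2.4 (p. 14 L35): «The centralizer of `ρ(Spin(V_ℚ)_P)` in `Õ(V_ℚ)` is `η(K^×)`.» Proof, p. 14 L36–53: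
  «The image of `η` clearly centralizes `ρ(Spin(V_ℚ)_P)`. Given `v₁, v′₁ ∈ W₁`, set `v = v₁ + σ(v₁)` and
  `v′ = v′₁ + σ(v′₁)`. Then `(η_λ(v), η_λ(v′))_V = (λv₁ + σ(λ)σ(v₁), λv′₁ + σ(λ)σ(v′₁))_V = Nm(λ)[(v₁, σ(v′₁))_V +
  (v′₁, σ(v₁))_V] = Nm(λ)(v, v′)`. Conversely, … `λ₁v₁ = g(v₁) = (σgσ)(v₁) = σ(λ₂σ(v₁)) = σ(λ₂)v₁`. Hence,
  `λ₂ = σ(λ₁)` and `g = η(λ₁)`. □»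
* §2.4, p. 19 L12–36: «Set (2.4.1) `f := η_{√−d} : V_ℚ → V_ℚ`, where `η` is given in (2.2.4) and we choose the square
  root `√−d := √d exp(iπ/2)` with argument `π/2`. … Note that `f` belongs to `Õ(V_ℚ)`, `(f(x), f(y))_V = d(x, y)_V`,
  and `f² = −d`, by Lemma 2.2.4. Hence `(f(x), y)_V = (1/d)(f²(x), f(y))_V = −(x, f(y))_V`, and so `f` is
  anti-self-dual. Let `Ξ_P ∈ ∧²V^*_ℚ` be the 2-form (2.4.2) `Ξ_P(x, y) := (f(x), y)_V`. … Note the equality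
  `Ξ_P(x, y) = √−d((x₁, y₂)_V − (x₂, y₁)_V)`, where `x = x₁ + x₂` is the decomposition with `x_i ∈ W_i`, `i = 1, 2`,
  and `y = y₁ + y₂` is the analogous decomposition. An element `v ∈ V_ℚ`, admits a unique decomposition
  `v = v₁^{1,0} + v₂^{1,0} + v₁^{0,1} + v₂^{0,1}`, where `v_i^{1,0} ∈ W_{i,ℂ} ∩ V^{1,0}` and `v_i^{0,1} ∈ W_{i,ℂ} ∩
  V^{0,1}`, by Lemma 2.2.6.»
* p. 20 L3–5: «… Furthermore, `I` commutes with `f`, by Lemma 2.2.6. Hence, `Ξ_P` is of Hodge-type `(1, 1)` and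
  `f ∘ I` is self-dual. We get the symmetric bilinear form on `V_ℝ` given by `g_P(x, y) := Ξ_P(I(x), y) =
  (f(I(x)), y)_V`.» LEMMA 2.4.2 (p. 20 L6–12): «`g_P(v, v) = 2√d(−(v₁^{1,0}, v₂^{0,1})_V + (v₁^{0,1}, v₂^{1,0})_V)`.»
  Proof (p. 20 L13–49): «Our sign convention for square roots yields `√−1√−d = −√d`. `(f(I(v)), v) =
  −√d(v₁^{1,0} − v₂^{1,0} − v₁^{0,1} + v₂^{0,1}, v₁^{1,0} + v₂^{1,0} + v₁^{0,1} + v₂^{0,1})_V =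
  −2√d((v₁^{1,0}, v₂^{0,1})_V − (v₁^{0,1}, v₂^{1,0})_V)`, where in the second equality we used the fact that `W_i`,
  `i = 1, 2`, `V^{1,0}`, and `V^{0,1}` are all isotropic with respect to the pairing (1.2.2). □»
* p. 21 L3–44: «Let `d` be a positive integer. Set `K := ℚ[√−d]`. Set `u := √−dΘ`. Cup product with `exp(u)` is a
  linear automorphism of `H^*(X, K)` corresponding to the spin representation image of an element `exp(u)` of
  `Spin(V_K)` which acts on `V_K` by (2.4.4) `exp(u) · (w, y) = (w − √−dθ(y), y)`, `w ∈ H¹(X, K)` and `y ∈ H¹(X̂, K) ≅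
  H¹(X, K)^*` … Note that `exp(u)` … leaves invariant every element of the latter subspace [`H¹(X, K)`]. … The
  maximal isotropic subspaces corresponding to `ℓ₁` and `ℓ₂` are (2.4.6) `W₁ := exp(u)(H¹(X, K)^*) =
  {(−√−dθ(y), y) : y ∈ H¹(X, K)^*}`, `W₂ := W̄₁ = {(+√−dθ(y), y) : y ∈ H¹(X, K)^*}`. The intersection `W₁ ∩ W₂`
  is the zero subspace, since `θ` is an isomorphism.» (`θ` = contraction with the ample class `Θ`, (2.4.3)).
* PROPOSITION 2.4.4 (p. 21 L45–46): «The symmetric bilinear pairing `g_P` of Lemma 2.4.2 associated with the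
  oriented plane `P` in (2.4.5) is negative definite.» — end of its proof, p. 22 L3–8: «Write `y = a + ib`, where
  `a, b` in `H¹(X̂, ℝ)`. Then `ȳ ∧ I(y) = (a − ib) ∧ (I(a) + iI(b)) = a ∧ I(a) + b ∧ I(b) + i[a ∧ I(b) − b ∧ I(a)]`.
  The fact that `Θ` is of type `(1, 1)` yields `Θ(a ∧ I(b)) = Θ(I(a) ∧ I²(b)) = −Θ(I(a) ∧ b) = Θ(b ∧ I(a))`. Hence,
  `Θ(ȳ ∧ I(y)) = Θ(a ∧ I(a)) + Θ(b ∧ I(b))`. The two summands are non-negative and the sum is non-zero if `y ≠ 0`,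
  as `Θ` is ample (we use the sign convention of [H1, Lemma 1.2.15]).»; the step before (p. 21 L104–109):
  «`= 2di[(−y^{1,0} + y^{0,1}, θ(ȳ))_V + (θ(y^{1,0} − y^{0,1}), ȳ)_V] = 2d[−(I(y), θ(ȳ))_V + (θ(I(y)), ȳ)_V]`».

## What this file proves (models with bodies + theorems; 0 named facts, 0 sorry)
§A — `V_K = W₁ ⊕ W₂` as `W₁ × W₂` with the pairing `pairV β x y = β(x₁, y₂) + β(y₁, x₂)` (so `W₁`, `W₂` are
isotropic and the form is symmetric: `pairV_symm`, `pairV_isotropic`); `eta λ μ` = multiplication by `λ` on `W₁` and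
by `μ` (playing `σ(λ)`) on `W₂`. `lemma_2_2_4_display`: `(η_λ v, η_λ v′)_V = (λμ)·(v, v′)_V` («`= Nm(λ)(v, v′)`»).
With `f := eta s (−s)` (`σ(√−d) = −√−d`) and `s² = −d`: `f_sq` (`f² = −d`), `f_multiplier` (`(f x, f y)_V =
d(x, y)_V` with `d = s·σ(s)`, `norm_sqrt`), `f_anti_self_dual`, `xi_formula` («`Ξ_P(x, y) = √−d((x₁, y₂)_V −
(x₂, y₁)_V)`») — the hypotheses of `ProductWeilTypeDiscriminant`'s Appendix, now derived.
§B — LEMMA 2.4.2 on the four-part decomposition `v = (v₁^{1,0}, v₁^{0,1}, v₂^{1,0}, v₂^{0,1})`: `pair4 β γ` keeps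
exactly the two pairings the six printed isotropies allow (`W₁, W₂, V^{1,0}, V^{0,1}` isotropic); `cxI` = `√−1` on
`V^{1,0}`, `−√−1` on `V^{0,1}`; `fW` = `s` on `W₁`, `−s` on `W₂`; with the printed convention `√−1·√−d = −√d`
(`i * s = −r`): `fI_apply` (the first display line), `lemma_2_4_2` (both printed forms), `gP_symm` («`f ∘ I` is
self-dual», so `g_P` is symmetric), `cxI_sq` (`I² = −1`), `f_comm_I`.
§C — (2.4.4)/(2.4.6) on `H¹(X, K) ⊕ H¹(X̂, K)` as `P × Q` with `θ : Q →ₗ P`: `expU s θ (w, y) = (w − s·θ(y), y)`;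
`expU_fixes_H1X`, `expU_on_dual` (`W₁ = {(−√−dθ(y), y)}`), `expU_neg` (`exp(−u)` inverts `exp(u)`),
`W1_inter_W2_eq_zero` («`W₁ ∩ W₂` is the zero subspace, since `θ` is an isomorphism» — with the honest side
condition `2√−d ≠ 0`, automatic in characteristic `0` for `d ≠ 0`).
§D — the `Θ(ȳ ∧ I(y))` expansion, for a bilinear `Θ` on a module over a commutative ring containing `i` with
`i² = −1`, `I` with `I² = −1` and `Θ(Iu, Iv) = Θ(u, v)` («type (1,1)»), `Θ` alternating: `conj_wedge_I_expansion`,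
`type11_swap` («`Θ(a ∧ I(b)) = … = Θ(b ∧ I(a))`»), `conj_wedge_I_real`; and `prop_2_4_4_step5` (the `2di ↦ 2d`
line: `i·(−y^{1,0} + y^{0,1}) = −I(y)`, `i·(y^{1,0} − y^{0,1}) = I(y)` for `I = ±i` on `V^{1,0}/V^{0,1}`).
BY VALUE (printed inputs, not modelled): `V_ℚ = {v₁ + σ(v₁)}`, the converse half of Lemma 2.2.4, Lemma 2.2.6, the
Hodge-theoretic type statements, `exp(u) ∈ Spin(V_K)` and its spin action, `W₂ = W̄₁`, the last equality
`= −4dΘ(ȳ ∧ I(y))` of the Prop. 2.4.4 chain (it uses footnote 9's identification of `θ`), and the positivity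
«non-negative … as `Θ` is ample». Nothing in this file says that HC / HC_CM / HC_AV is proved or that any object is
semiregular or hyperholomorphic.
-/

namespace Literature.AlgebraicGeometry.Markman2025.EtaSimilarity

/-! ### §A. `η_λ` on `V_K = W₁ ⊕ W₂`, Lemma 2.2.4's display, and `f := η_{√−d}` -/

section Eta

variable {K : Type*} [Field K] {W₁ W₂ : Type*} [AddCommGroup W₁] [Module K W₁] [AddCommGroup W₂] [Module K W₂]

/-- The pairing `(•, •)_V` on `V_K = W₁ ⊕ W₂` with `W₁`, `W₂` maximal ISOTROPIC (p. 14 L23–24): only the cross pairing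
`β : W₁ × W₂ → K` survives, `(x, y)_V = β(x₁, y₂) + β(y₁, x₂)`. A MODEL of the printed setting.
[cite: Markman2025SecantWeil, §2.2, p. 14 L20–28] -/
def pairV (β : W₁ →ₗ[K] W₂ →ₗ[K] K) (x y : W₁ × W₂) : K :=
  β x.1 y.2 + β y.1 x.2

/-- «let `η_λ : V_K → V_K` act on `W₁` by multiplication by `λ` and on `W₂` by multiplication by `σ(λ)`» — here `μ`
plays `σ(λ)`. [cite: Markman2025SecantWeil, (2.2.4), p. 14 L29–34] -/
def eta (lam mu : K) (x : W₁ × W₂) : W₁ × W₂ :=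
  (lam • x.1, mu • x.2)

/-- The model pairing is symmetric (as (1.2.2) is). [cite: Markman2025SecantWeil, §2.2, p. 14 L20–28] -/
theorem pairV_symm (β : W₁ →ₗ[K] W₂ →ₗ[K] K) (x y : W₁ × W₂) : pairV β x y = pairV β y x := by
  unfold pairV; ring

/-- «two maximal isotropic subspaces `W₁` and `W₂` of `V_K`»: both are isotropic for `pairV`.
[cite: Markman2025SecantWeil, §2.2, p. 14 L20–24] -/
theorem pairV_isotropic (β : W₁ →ₗ[K] W₂ →ₗ[K] K) (x₁ y₁ : W₁) (x₂ y₂ : W₂) :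
    pairV β (x₁, 0) (y₁, 0) = 0 ∧ pairV β (0, x₂) (0, y₂) = 0 := by
  simp [pairV]

/-- LEMMA 2.2.4, the display: «`(η_λ(v), η_λ(v′))_V = (λv₁ + σ(λ)σ(v₁), λv′₁ + σ(λ)σ(v′₁))_V = Nm(λ)[(v₁, σ(v′₁))_V +
(v′₁, σ(v₁))_V] = Nm(λ)(v, v′)`», `Nm(λ) = λσ(λ)`: `η_λ` is a similarity with multiplier `λ·σ(λ)`.
[cite: Markman2025SecantWeil, Lemma 2.2.4 (proof), p. 14 L36–49] -/
theorem lemma_2_2_4_display (β : W₁ →ₗ[K] W₂ →ₗ[K] K) (lam mu : K) (v v' : W₁ × W₂) :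
    pairV β (eta lam mu v) (eta lam mu v') = (lam * mu) * pairV β v v' := by
  simp only [pairV, eta, map_smul, LinearMap.smul_apply, smul_eq_mul]
  ring

/-- «`Nm(λ) = λσ(λ)`» at `λ = √−d` (`σ(√−d) = −√−d`): `Nm(√−d) = d` when `s² = −d`.
[cite: Markman2025SecantWeil, (2.4.1), p. 19 L23 (with Nm from p. 14 L16–17)] -/
theorem norm_sqrt (d s : K) (hs : s ^ 2 = -d) : s * (-s) = d := by
  linear_combination (-1 : K) * hs

/-- (2.4.1) «`f := η_{√−d}`» … «and `f² = −d`, by Lemma 2.2.4»: with `s² = −d`, `σ(s) = −s`, `η_s(η_s x) = −d·x`.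
[cite: Markman2025SecantWeil, (2.4.1), p. 19 L12–24] -/
theorem f_sq (d s : K) (hs : s ^ 2 = -d) (x : W₁ × W₂) : eta s (-s) (eta s (-s) x) = (-d) • x := by
  have h2 : s * s = -d := by rw [← pow_two, hs]
  ext <;> simp [eta, smul_smul, h2]

/-- (2.4.1) «Note that `f` belongs to `Õ(V_ℚ)`, `(f(x), f(y))_V = d(x, y)_V`»: the multiplier of `f = η_{√−d}` is
`Nm(√−d) = d ∈ Nm(K^×)` ((2.2.3)). [cite: Markman2025SecantWeil, (2.4.1), p. 19 L23 / (2.2.3), p. 14 L18–19] -/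
theorem f_multiplier (β : W₁ →ₗ[K] W₂ →ₗ[K] K) (d s : K) (hs : s ^ 2 = -d) (x y : W₁ × W₂) :
    pairV β (eta s (-s) x) (eta s (-s) y) = d * pairV β x y := by
  rw [lemma_2_2_4_display, norm_sqrt d s hs]

/-- «Hence `(f(x), y)_V = (1/d)(f²(x), f(y))_V = −(x, f(y))_V`, and so `f` is anti-self-dual» — directly in the model
(no division by `d` needed). [cite: Markman2025SecantWeil, (2.4.1), p. 19 L24–27] -/
theorem f_anti_self_dual (β : W₁ →ₗ[K] W₂ →ₗ[K] K) (s : K) (x y : W₁ × W₂) :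
    pairV β (eta s (-s) x) y = -pairV β x (eta s (-s) y) := by
  simp only [pairV, eta, map_smul, LinearMap.smul_apply, smul_eq_mul, map_neg, neg_smul]
  ring

/-- (2.4.2) «Note the equality `Ξ_P(x, y) = √−d((x₁, y₂)_V − (x₂, y₁)_V)`», `Ξ_P(x, y) := (f(x), y)_V`, with
`(x₁, y₂)_V`, `(x₂, y₁)_V` the pairings of the components embedded in `V`.
[cite: Markman2025SecantWeil, (2.4.2), p. 19 L27–36] -/
theorem xi_formula (β : W₁ →ₗ[K] W₂ →ₗ[K] K) (s : K) (x y : W₁ × W₂) :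
    pairV β (eta s (-s) x) y = s * (pairV β (x.1, 0) (0, y.2) - pairV β (0, x.2) (y.1, 0)) := by
  simp only [pairV, eta, map_smul, LinearMap.smul_apply, smul_eq_mul, map_zero, neg_smul, map_neg]
  ring

end Eta

/-! ### §B. Lemma 2.4.2: `g_P(v, v)` on the decomposition `v = v₁^{1,0} + v₁^{0,1} + v₂^{1,0} + v₂^{0,1}` -/

section GP

variable {K : Type*} [Field K] {A B C E : Type*} [AddCommGroup A] [Module K A] [AddCommGroup B] [Module K B]
  [AddCommGroup C] [Module K C] [AddCommGroup E] [Module K E]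

/-- The pairing on `V_ℂ = W₁^{1,0} ⊕ W₁^{0,1} ⊕ W₂^{1,0} ⊕ W₂^{0,1}` (components `(a, b, c, e)` of types `A, B, C, E`)
compatible with «`W_i`, `i = 1, 2`, `V^{1,0}`, and `V^{0,1}` are all isotropic» (p. 20 L48–49): of the ten pairings
of components only `(v₁^{1,0}, v₂^{0,1})_V` (`β`) and `(v₁^{0,1}, v₂^{1,0})_V` (`γ`) can be non-zero. A MODEL.
[cite: Markman2025SecantWeil, Lemma 2.4.2 (proof), p. 20 L13–49] -/
def pair4 (β : A →ₗ[K] E →ₗ[K] K) (γ : B →ₗ[K] C →ₗ[K] K) (v v' : A × B × C × E) : K :=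
  β v.1 v'.2.2.2 + β v'.1 v.2.2.2 + γ v.2.1 v'.2.2.1 + γ v'.2.1 v.2.2.1

/-- The complex structure `I`: `√−1` on `V^{1,0} = A ⊕ C`, `−√−1` on `V^{0,1} = B ⊕ E` (`i` plays `√−1`).
[cite: Markman2025SecantWeil, §2.4, p. 19 L61 – p. 20 L3] -/
def cxI (i : K) (v : A × B × C × E) : A × B × C × E :=
  (i • v.1, -(i • v.2.1), i • v.2.2.1, -(i • v.2.2.2))

/-- `f = η_{√−d}`: `√−d` on `W₁ = A ⊕ B`, `σ(√−d) = −√−d` on `W₂ = C ⊕ E` (`s` plays `√−d`).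
[cite: Markman2025SecantWeil, (2.4.1), p. 19 L12–16] -/
def fW (s : K) (v : A × B × C × E) : A × B × C × E :=
  (s • v.1, s • v.2.1, -(s • v.2.2.1), -(s • v.2.2.2))

/-- `I² = −1` when `i² = −1`. [cite: Markman2025SecantWeil, §2.4, p. 19 L61] -/
theorem cxI_sq (i : K) (hi : i ^ 2 = -1) (v : A × B × C × E) : cxI i (cxI i v) = -v := by
  have h2 : i * i = -1 := by rw [← pow_two, hi]
  ext <;> simp [cxI, smul_smul, h2]

/-- «Furthermore, `I` commutes with `f`, by Lemma 2.2.6» — automatic once both are diagonal on the four summands.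
[cite: Markman2025SecantWeil, §2.4, p. 20 L3] -/
theorem f_comm_I (i s : K) (v : A × B × C × E) : fW s (cxI i v) = cxI i (fW s v) := by
  ext <;> simp [cxI, fW, smul_smul, mul_comm]

/-- LEMMA 2.4.2, first display line: «Our sign convention for square roots yields `√−1√−d = −√d`. `(f(I(v)), v) =
−√d(v₁^{1,0} − v₂^{1,0} − v₁^{0,1} + v₂^{0,1}, …)_V`» — i.e. `f(I(v)) = −√d·(v₁^{1,0}, −v₁^{0,1}, −v₂^{1,0}, v₂^{0,1})`
when `i·s = −r` (`r` playing `√d`). [cite: Markman2025SecantWeil, Lemma 2.4.2 (proof), p. 20 L13–36] -/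
theorem fI_apply (i s r : K) (hconv : i * s = -r) (v : A × B × C × E) :
    fW s (cxI i v) = (-r) • (v.1, -v.2.1, -v.2.2.1, v.2.2.2) := by
  have h : s * i = -r := by rw [mul_comm, hconv]
  ext <;> simp [cxI, fW, smul_smul, h]

/-- LEMMA 2.4.2: «`g_P(v, v) = 2√d(−(v₁^{1,0}, v₂^{0,1})_V + (v₁^{0,1}, v₂^{1,0})_V)`» with `g_P(x, y) := (f(I(x)), y)_V`,
and the proof's second line «`= −2√d((v₁^{1,0}, v₂^{0,1})_V − (v₁^{0,1}, v₂^{1,0})_V)`»; the component pairings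
are those of the embedded components. [cite: Markman2025SecantWeil, Lemma 2.4.2, p. 20 L6–49] -/
theorem lemma_2_4_2 (β : A →ₗ[K] E →ₗ[K] K) (γ : B →ₗ[K] C →ₗ[K] K) (i s r : K) (hconv : i * s = -r)
    (v : A × B × C × E) :
    pair4 β γ (fW s (cxI i v)) v
        = 2 * r * (-(pair4 β γ (v.1, 0, 0, 0) (0, 0, 0, v.2.2.2)) + pair4 β γ (0, v.2.1, 0, 0) (0, 0, v.2.2.1, 0))
      ∧ pair4 β γ (fW s (cxI i v)) v
        = -(2 * r) * (pair4 β γ (v.1, 0, 0, 0) (0, 0, 0, v.2.2.2) - pair4 β γ (0, v.2.1, 0, 0) (0, 0, v.2.2.1, 0)) := by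
  have h : s * i = -r := by rw [mul_comm, hconv]
  constructor <;>
  · simp only [pair4, fW, cxI, smul_smul, h, map_smul, map_neg, map_zero, LinearMap.smul_apply,
      LinearMap.neg_apply, smul_eq_mul, neg_smul, smul_neg]
    ring

/-- «`f ∘ I` is self-dual. We get the symmetric bilinear form on `V_ℝ` given by `g_P(x, y) := Ξ_P(I(x), y) =
(f(I(x)), y)_V`»: in the model `(f(I(x)), y)_V = (x, f(I(y)))_V`, so `g_P` is symmetric.
[cite: Markman2025SecantWeil, §2.4, p. 20 L3–5] -/
theorem gP_symm (β : A →ₗ[K] E →ₗ[K] K) (γ : B →ₗ[K] C →ₗ[K] K) (i s : K) (x y : A × B × C × E) :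
    pair4 β γ (fW s (cxI i x)) y = pair4 β γ (fW s (cxI i y)) x := by
  simp only [pair4, fW, cxI, smul_smul, map_smul, map_neg, LinearMap.smul_apply, LinearMap.neg_apply, smul_eq_mul,
    smul_neg]
  ring

end GP

/-! ### §C. (2.4.4)–(2.4.6): `exp(u)` on `H¹(X, K) ⊕ H¹(X̂, K)` and `W₁ ∩ W₂ = 0` -/

section ExpU

variable {K : Type*} [Field K] {P Q : Type*} [AddCommGroup P] [Module K P] [AddCommGroup Q] [Module K Q]

/-- (2.4.4) «`exp(u) · (w, y) = (w − √−dθ(y), y)`, `w ∈ H¹(X, K)` and `y ∈ H¹(X̂, K) ≅ H¹(X, K)^*`» (`u = √−dΘ`,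
`θ` = contraction with `Θ`, (2.4.3)); `s` plays `√−d`. [cite: Markman2025SecantWeil, (2.4.4), p. 21 L3–14] -/
def expU (s : K) (θ : Q →ₗ[K] P) (v : P × Q) : P × Q :=
  (v.1 - s • θ v.2, v.2)

/-- «`exp(u)` … leaves invariant every element of the latter subspace» `H¹(X, K)` (the `w`-axis).
[cite: Markman2025SecantWeil, §2.4, p. 21 L14–17] -/
theorem expU_fixes_H1X (s : K) (θ : Q →ₗ[K] P) (w : P) : expU s θ (w, 0) = (w, 0) := by
  simp [expU]

/-- (2.4.6) «`W₁ := exp(u)(H¹(X, K)^*) = {(−√−dθ(y), y) : y ∈ H¹(X, K)^*}`»: the image of `(0, y)`.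
[cite: Markman2025SecantWeil, (2.4.6), p. 21 L27–36] -/
theorem expU_on_dual (s : K) (θ : Q →ₗ[K] P) (y : Q) : expU s θ (0, y) = (-(s • θ y), y) := by
  simp [expU]

/-- `exp(−u)` inverts `exp(u)` on `V_K` (so `exp(u)` is an automorphism, as printed: «a linear automorphism»).
[cite: Markman2025SecantWeil, §2.4, p. 21 L7–9] -/
theorem expU_neg (s : K) (θ : Q →ₗ[K] P) (v : P × Q) : expU (-s) θ (expU s θ v) = v := by
  ext <;> simp [expU]

/-- «The intersection `W₁ ∩ W₂` is the zero subspace, since `θ` is an isomorphism» — with `W₂ = {(+√−dθ(y), y)}`: a common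
element `(−√−dθ(y), y) = (√−dθ(y′), y′)` forces `y = y′` and `2√−d·θ(y) = 0`, hence `y = 0` for `θ` injective and
`2√−d ≠ 0` (the latter is the honest side condition; automatic in characteristic `0` when `d ≠ 0`).
[cite: Markman2025SecantWeil, (2.4.6), p. 21 L37–44] -/
theorem W1_inter_W2_eq_zero (s : K) (θ : Q →ₗ[K] P) (hθ : Function.Injective θ) (h2s : (2 : K) * s ≠ 0)
    (y y' : Q) (h : ((-(s • θ y), y) : P × Q) = (s • θ y', y')) : y = 0 ∧ y' = 0 := by
  have hy : y = y' := (Prod.ext_iff.mp h).2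
  subst hy
  have h1 : -(s • θ y) = s • θ y := (Prod.ext_iff.mp h).1
  have h2 : ((2 : K) * s) • θ y = 0 := by
    rw [mul_smul, two_smul]
    nth_rewrite 1 [← h1]
    exact neg_add_cancel _
  have h3 : θ y = 0 := by
    rcases smul_eq_zero.mp h2 with h0 | h0
    · exact absurd h0 h2s
    · exact h0
  have h4 : y = 0 := hθ (by rw [h3, map_zero])
  exact ⟨h4, h4⟩

/-- In characteristic `0` the side condition `2√−d ≠ 0` is just `d ≠ 0` (`s² = −d`).
[cite: Markman2025SecantWeil, (2.4.6), p. 21 L44] -/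
theorem two_sqrt_ne_zero [CharZero K] (d s : K) (hs : s ^ 2 = -d) (hd : d ≠ 0) : (2 : K) * s ≠ 0 := by
  refine mul_ne_zero two_ne_zero ?_
  rintro rfl
  apply hd
  have : (0 : K) ^ 2 = -d := hs
  simpa using this.symm

end ExpU

/-! ### §D. Proposition 2.4.4, end of proof: the `Θ(ȳ ∧ I(y))` expansion -/

section ThetaExpansion

variable {S : Type*} [CommRing S] {M : Type*} [AddCommGroup M] [Module S M]

/-- «Write `y = a + ib` … Then `ȳ ∧ I(y) = (a − ib) ∧ (I(a) + iI(b)) = a ∧ I(a) + b ∧ I(b) + i[a ∧ I(b) − b ∧ I(a)]`» —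
read after applying the bilinear `Θ` (only `Θ(ȳ ∧ I(y))` is used), for `I` linear and `i² = −1`.
[cite: Markman2025SecantWeil, Proposition 2.4.4 (proof), p. 22 L3–4] -/
theorem conj_wedge_I_expansion (Θ : M →ₗ[S] M →ₗ[S] S) (I : M →ₗ[S] M) (i : S) (hi : i * i = -1) (a b : M) :
    Θ (a - i • b) (I a + i • I b) = Θ a (I a) + Θ b (I b) + i * (Θ a (I b) - Θ b (I a)) := by
  simp only [map_sub, map_add, map_smul, LinearMap.sub_apply, LinearMap.smul_apply, smul_eq_mul]
  have : i * (i * Θ b (I b)) = -Θ b (I b) := by rw [← mul_assoc, hi, neg_one_mul]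
  linear_combination (-1 : S) * this

/-- «The fact that `Θ` is of type `(1, 1)` yields `Θ(a ∧ I(b)) = Θ(I(a) ∧ I²(b)) = −Θ(I(a) ∧ b) = Θ(b ∧ I(a))`» — for
`Θ` alternating (it is a 2-form), `I² = −1`, and «type (1,1)» read as `Θ(Iu ∧ Iv) = Θ(u ∧ v)`.
[cite: Markman2025SecantWeil, Proposition 2.4.4 (proof), p. 22 L4–5] -/
theorem type11_swap (Θ : M →ₗ[S] M →ₗ[S] S) (halt : ∀ u v, Θ u v = -Θ v u) (I : M →ₗ[S] M)
    (hI : ∀ u, I (I u) = -u) (h11 : ∀ u v, Θ (I u) (I v) = Θ u v) (a b : M) :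
    Θ a (I b) = Θ (I a) (I (I b)) ∧ Θ (I a) (I (I b)) = -Θ (I a) b ∧ -Θ (I a) b = Θ b (I a) := by
  refine ⟨(h11 a (I b)).symm, ?_, ?_⟩
  · rw [hI, map_neg]
  · rw [halt (I a) b, neg_neg]

/-- «Hence, `Θ(ȳ ∧ I(y)) = Θ(a ∧ I(a)) + Θ(b ∧ I(b))`» (the imaginary part cancels). The positivity of the two
summands («as `Θ` is ample») is BY VALUE. [cite: Markman2025SecantWeil, Proposition 2.4.4 (proof), p. 22 L6] -/
theorem conj_wedge_I_real (Θ : M →ₗ[S] M →ₗ[S] S) (halt : ∀ u v, Θ u v = -Θ v u) (I : M →ₗ[S] M)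
    (hI : ∀ u, I (I u) = -u) (h11 : ∀ u v, Θ (I u) (I v) = Θ u v) (i : S) (hi : i * i = -1) (a b : M) :
    Θ (a - i • b) (I a + i • I b) = Θ a (I a) + Θ b (I b) := by
  obtain ⟨h1, h2, h3⟩ := type11_swap Θ halt I hI h11 a b
  rw [conj_wedge_I_expansion Θ I i hi, h1, h2, h3, sub_self, mul_zero, add_zero]

/-- Proposition 2.4.4, the `2di ↦ 2d` line: «`= 2di[(−y^{1,0} + y^{0,1}, θ(ȳ))_V + (θ(y^{1,0} − y^{0,1}), ȳ)_V] =
2d[−(I(y), θ(ȳ))_V + (θ(I(y)), ȳ)_V]`» — the vector identities behind it, for `I = √−1` on `y^{1,0}` and `−√−1` on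
`y^{0,1}` (`I(y) = iy^{1,0} − iy^{0,1}`): `i(−y^{1,0} + y^{0,1}) = −I(y)` and `i(y^{1,0} − y^{0,1}) = I(y)`.
[cite: Markman2025SecantWeil, Proposition 2.4.4 (proof), p. 21 L104–109] -/
theorem prop_2_4_4_step5 (i : S) (y10 y01 : M) :
    i • (-y10 + y01) = -(i • y10 - i • y01) ∧ i • (y10 - y01) = i • y10 - i • y01 := by
  constructor
  · rw [smul_add, smul_neg, neg_sub, sub_eq_neg_add]
  · rw [smul_sub]

end ThetaExpansion

end Literature.AlgebraicGeometry.Markman2025.EtaSimilarity
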